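import Summits.CriticalPhenomena.PercolationContinuityZ3.Theorems.PercNearOneGluingAdditiveGluingKnThm2Refined
import Summits.CriticalPhenomena.PercolationContinuityZ3.Theorems.PercNearOneGluingNoHeavyLowerTailWorstPairExchange

/-!
# `NoHeavyLowerTail` (stmt-CriticalPhenomena-4575) — the REFINED Kozma–Nitzan residual `(RKNS)_k` for any number of relays:
# `(RKNS)_k ⟹ EG_k` (sharp event gluing) and `(∀ graphs, (RKNS) at a worst relay) ⟹ NoHeavyLowerTail`

Support file (prover `prim-ineq-prove-4`, new-inequality factory; `--supports stmt-CriticalPhenomena-4575`). No definitions, no sorries.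
Setting: `μ = prodBernoulli w` on `Fin n`, relays `A`, observer `o ∉ A`, sink `c`, designated relay `z ∈ A`; for `∅ ≠ S ⊆ A ∖ {z}`,
`R = A ∖ S`, `N'_S = {S ∪ {o} ↮ R}`, `P_S = μ(N'_S)`, `A_S = μ(N'_S ∩ {o ↔ S})`, `m_S = μ(N'_S ∩ {c ↔ all S})`, `m_R = μ(N'_S ∩ {c ↔ all R})`,
`Z = μ(o ↮ A, z ↮ c)`.  `RKNS.X_ge_sum`: `μ(o↔A, o↔c) − μ(o↔A, z↔c) ≥ Σ_S (T_S − U_S)` (trace decomposition = the k-relay form of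
Kozma–Nitzan's `X = I + II + III`, arXiv:2401.12397 Thm. 2) with the two refined set-BHK steps per `S` (tree `knRef_bhkOne/Two`, source set
`S ∪ {o}`): `A_S m_S ≤ P_S T_S`, `P_S U_S ≤ A_S m_R`.  `eventGluing_of_rkns_at`: the row `(RKNS): Σ_S (A_S/P_S)(m_S − m_R) + Z ≥ 0` gives
`μ({o↔A} ∖ {o↔c}) ≤ μ(z ↮ c)` (k = 3: `eg3_of_refinedResidual`).  `noHeavyLowerTail_of_rkns`: (RKNS) at a worst relay on every finite
weighted graph ⟹ event gluing for every k ⟹ the crux (tree `noHeavyLowerTail_of_eventGluing`).  The un-refined row is FALSE at k = 3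
(tree `not_knResidualRow`); (RKNS)_k has no known violation (seat census k = 3,4,5; memo prim-ineq-prove-4/RKNS-CANDIDATE.md).
-/

namespace Summit.CriticalPhenomena.PercolationContinuityZ3.Theorems

open MeasureTheory Set Literature.Probability.LatticeModels Literature.Probability.Percolation

noncomputable section
open Classical

variable {n : ℕ}

namespace RKNS

/-- Trace partition: `μ(E) = Σ_{S ⊆ A} μ(E ∩ {∀ a ∈ A, c ↔ a ↔ a ∈ S})`. [folklore] -/
theorem sum_trace (w : Sym2 (Fin n) → unitInterval) (A : Finset (Fin n)) (c : Fin n) (E : Set (BondConfig (Fin n))) :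
    (prodBernoulli w).real E =
      ∑ S ∈ A.powerset, (prodBernoulli w).real (E ∩ {ω | ∀ a ∈ A, (openGraph ω).Reachable c a ↔ a ∈ S}) := by
  have hdisj : Set.PairwiseDisjoint (↑A.powerset : Set (Finset (Fin n)))
      fun S => E ∩ {ω | ∀ a ∈ A, (openGraph ω).Reachable c a ↔ a ∈ S} := by
    intro S hS S' hS' hne
    rw [Function.onFun, Set.disjoint_left]
    rintro ω ⟨-, h1⟩ ⟨-, h2⟩
    refine hne (Finset.ext fun a => ?_)
    have hSA : S ⊆ A := Finset.mem_powerset.1 (Finset.mem_coe.1 hS)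
    have hS'A : S' ⊆ A := Finset.mem_powerset.1 (Finset.mem_coe.1 hS')
    by_cases haA : a ∈ A
    · exact (h1 a haA).symm.trans (h2 a haA)
    · exact ⟨fun h => absurd (hSA h) haA, fun h => absurd (hS'A h) haA⟩
  have hcover : E = ⋃ S ∈ A.powerset, E ∩ {ω | ∀ a ∈ A, (openGraph ω).Reachable c a ↔ a ∈ S} := by
    ext ω
    simp only [mem_iUnion, mem_inter_iff, mem_setOf_eq, exists_prop]
    constructor
    · intro hE
      refine ⟨A.filter fun a => (openGraph ω).Reachable c a, Finset.mem_powerset.2 (Finset.filter_subset _ _), hE,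
        fun a ha => ?_⟩
      simp only [Finset.mem_filter]
      exact ⟨fun h => ⟨ha, h⟩, fun h => h.2⟩
    · rintro ⟨S, -, hE, -⟩; exact hE
  conv_lhs => rw [hcover]
  exact measureReal_biUnion_finset hdisj fun S _ => MeasurableSet.of_discrete

/-! ### The two set identities behind `X ≥ Σ_S (T_S − U_S)` -/

/-- For `∅ ≠ S ⊆ A` with `o ∉ A`: `{o↔A} ∩ {o↔c} ∩ {tr = S} ⊆ N'_S ∩ {o ↔ S} ∩ {c ↔ all S}` (in fact equal). [folklore] -/
theorem posTrace_subset (A S : Finset (Fin n)) (o c : Fin n) (hSA : S ⊆ A) :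
    (⋃ a ∈ A, (openConn o a : Set (BondConfig (Fin n)))) ∩ openConn o c ∩
        {ω | ∀ a ∈ A, (openGraph ω).Reachable c a ↔ a ∈ S} ⊆
      {ω : BondConfig (Fin n) | ∀ s ∈ insert o S, ∀ x ∈ A \ S, ¬ (openGraph ω).Reachable s x} ∩
        ((⋃ s ∈ S, (openConn s o : Set (BondConfig (Fin n)))) ∩ ⋂ s ∈ S, (openConn s c : Set (BondConfig (Fin n)))) := by
  rintro ω ⟨⟨hoA, hoc⟩, htr⟩
  rw [knThm2_mem_openConn] at hoc
  simp only [mem_setOf_eq] at htr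
  obtain ⟨a, haA, hoa⟩ : ∃ a ∈ A, (openGraph ω).Reachable o a := by
    simpa only [mem_iUnion, knThm2_mem_openConn, exists_prop] using hoA
  have haS : a ∈ S := (htr a haA).1 (hoc.symm.trans hoa)
  refine ⟨?_, ?_, ?_⟩
  · simp only [mem_setOf_eq, Finset.mem_insert, Finset.mem_sdiff]
    rintro s hs x ⟨hxA, hxS⟩ hsx
    rcases hs with rfl | hsS
    · exact hxS ((htr x hxA).1 (hoc.symm.trans hsx))
    · have hcs : (openGraph ω).Reachable c s := (htr s (hSA hsS)).2 hsS
      exact hxS ((htr x hxA).1 (hcs.trans hsx))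
  · simp only [mem_iUnion, knThm2_mem_openConn, exists_prop]
    exact ⟨a, haS, hoa.symm⟩
  · simp only [mem_iInter, knThm2_mem_openConn]
    intro s hsS
    exact ((htr s (hSA hsS)).2 hsS).symm

/-- `{o↔A} ∩ {z↔c} ∩ {o↮c} ⊆ ⋃_{∅≠S⊆A∖z} N'_S ∩ {o↔S} ∩ {c ↔ all of A∖S}` (take `S = A ∖ tr`). [folklore] -/
theorem negEvent_subset (A : Finset (Fin n)) (o c z : Fin n) (ho : o ∉ A) :
    (⋃ a ∈ A, (openConn o a : Set (BondConfig (Fin n)))) ∩ openConn z c ∩ (openConn o c)ᶜ ⊆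
      ⋃ S ∈ (A.erase z).powerset.filter (fun S => S.Nonempty),
        ({ω : BondConfig (Fin n) | ∀ s ∈ insert o S, ∀ x ∈ A \ S, ¬ (openGraph ω).Reachable s x} ∩
          ((⋃ s ∈ S, (openConn s o : Set (BondConfig (Fin n)))) ∩
            ⋂ x ∈ A \ S, (openConn x c : Set (BondConfig (Fin n))))) := by
  rintro ω ⟨⟨hoA, hzc⟩, hoc⟩
  rw [knThm2_mem_openConn] at hzc
  rw [mem_compl_iff, knThm2_mem_openConn] at hoc
  obtain ⟨a, haA, hoa⟩ : ∃ a ∈ A, (openGraph ω).Reachable o a := by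
    simpa only [mem_iUnion, knThm2_mem_openConn, exists_prop] using hoA
  set S : Finset (Fin n) := A.filter fun x => ¬ (openGraph ω).Reachable c x with hS
  have haS : a ∈ S := by
    rw [hS, Finset.mem_filter]
    exact ⟨haA, fun hca => hoc (hoa.trans hca.symm)⟩
  simp only [mem_iUnion, exists_prop]
  refine ⟨S, ?_, ?_, ?_, ?_⟩
  · rw [Finset.mem_filter, Finset.mem_powerset]
    refine ⟨fun x hx => ?_, ⟨a, haS⟩⟩
    rw [hS, Finset.mem_filter] at hx
    rw [Finset.mem_erase]
    exact ⟨fun hxz => hx.2 (by rw [hxz]; exact hzc.symm), hx.1⟩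
  · simp only [mem_setOf_eq, Finset.mem_insert, Finset.mem_sdiff]
    rintro s hs x ⟨hxA, hxS⟩ hsx
    have hcx : (openGraph ω).Reachable c x := by
      by_contra hcx
      exact hxS (by rw [hS, Finset.mem_filter]; exact ⟨hxA, hcx⟩)
    rcases hs with rfl | hsS
    · exact hoc (hsx.trans hcx.symm)
    · rw [hS, Finset.mem_filter] at hsS
      exact hsS.2 (hcx.trans hsx.symm)
  · simp only [mem_iUnion, knThm2_mem_openConn, exists_prop]
    exact ⟨a, haS, hoa.symm⟩
  · simp only [mem_iInter, knThm2_mem_openConn, Finset.mem_sdiff]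
    rintro x ⟨hxA, hxS⟩
    by_contra hxc
    exact hxS (by rw [hS, Finset.mem_filter]; exact ⟨hxA, fun h => hxc h.symm⟩)

/-- The positive part: `μ(o↔A, o↔c) ≥ μ(o↔c, z↔c) + Σ_{∅≠S⊆A∖z} T_S`. [folklore] -/
theorem pos_ge (w : Sym2 (Fin n) → unitInterval) (A : Finset (Fin n)) (o c z : Fin n) (hz : z ∈ A) :
    (prodBernoulli w).real (openConn o c ∩ openConn z c) +
      ∑ S ∈ (A.erase z).powerset.filter (fun S => S.Nonempty),
        (prodBernoulli w).real
          ({ω : BondConfig (Fin n) | ∀ s ∈ insert o S, ∀ x ∈ A \ S, ¬ (openGraph ω).Reachable s x} ∩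
            ((⋃ s ∈ S, (openConn s o : Set (BondConfig (Fin n)))) ∩ ⋂ s ∈ S, (openConn s c : Set (BondConfig (Fin n))))) ≤
      (prodBernoulli w).real ((⋃ a ∈ A, (openConn o a : Set (BondConfig (Fin n)))) ∩ openConn o c) := by
  rw [sum_trace w A c ((⋃ a ∈ A, (openConn o a : Set (BondConfig (Fin n)))) ∩ openConn o c)]
  rw [← Finset.sum_filter_add_sum_filter_not A.powerset (fun S => z ∈ S)]
  apply add_le_add
  · -- `{o↔c} ∩ {z↔c} = ⋃_{S ∋ z} E ∩ {tr = S}`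
    have hcov : (openConn o c : Set (BondConfig (Fin n))) ∩ openConn z c ⊆
        ⋃ S ∈ A.powerset.filter (fun S => z ∈ S),
          ((⋃ a ∈ A, (openConn o a : Set (BondConfig (Fin n)))) ∩ openConn o c) ∩
            {ω | ∀ a ∈ A, (openGraph ω).Reachable c a ↔ a ∈ S} := by
      rintro ω ⟨hoc, hzc⟩
      rw [knThm2_mem_openConn] at hoc hzc
      simp only [mem_iUnion, exists_prop, Finset.mem_filter, Finset.mem_powerset]
      refine ⟨A.filter fun a => (openGraph ω).Reachable c a, ⟨Finset.filter_subset _ _, ?_⟩, ?_, fun a ha => ?_⟩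
      · rw [Finset.mem_filter]; exact ⟨hz, hzc.symm⟩
      · refine ⟨?_, by rw [knThm2_mem_openConn]; exact hoc⟩
        simp only [mem_iUnion, knThm2_mem_openConn, exists_prop]
        exact ⟨z, hz, hoc.trans hzc.symm⟩
      · simp only [Finset.mem_filter]; exact ⟨fun h => ⟨ha, h⟩, fun h => h.2⟩
    exact (measureReal_mono (h₂ := measure_ne_top _ _) hcov).trans (measureReal_biUnion_finset_le _ _)
  · -- reindex: nonempty subsets of `A.erase z` are exactly the `S ⊆ A` with `z ∉ S`, `S ≠ ∅`; the empty trace carries no mass of `E`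
    have hsub : (A.erase z).powerset.filter (fun S => S.Nonempty) ⊆ A.powerset.filter (fun S => z ∉ S) := by
      intro S hS
      rw [Finset.mem_filter, Finset.mem_powerset] at hS ⊢
      exact ⟨hS.1.trans (Finset.erase_subset z A), fun hzS => by simpa using hS.1 hzS⟩
    refine le_trans (Finset.sum_le_sum fun S hS => ?_) (Finset.sum_le_sum_of_subset_of_nonneg hsub fun _ _ _ => measureReal_nonneg)
    rw [Finset.mem_filter, Finset.mem_powerset] at hS
    have hSA : S ⊆ A := hS.1.trans (Finset.erase_subset z A)
    refine measureReal_mono (h₂ := measure_ne_top _ _) ?_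
    rintro ω ⟨hN, hU, hV⟩
    simp only [mem_setOf_eq, Finset.mem_insert, Finset.mem_sdiff] at hN
    simp only [mem_iUnion, knThm2_mem_openConn, exists_prop] at hU
    simp only [mem_iInter, knThm2_mem_openConn] at hV
    obtain ⟨s, hsS, hso⟩ := hU
    have hcs : (openGraph ω).Reachable c s := (hV s hsS).symm
    have hoc : (openGraph ω).Reachable o c := hso.symm.trans hcs.symm
    refine ⟨⟨?_, by rw [knThm2_mem_openConn]; exact hoc⟩, fun a haA => ⟨fun hca => ?_, fun haS => (hV a haS).symm⟩⟩
    · simp only [mem_iUnion, knThm2_mem_openConn, exists_prop]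
      exact ⟨s, hSA hsS, hso.symm⟩
    · by_contra haS
      exact hN o (Or.inl rfl) a ⟨haA, haS⟩ (hoc.trans hca)

/-- The negative part: `μ(o↔A, z↔c) ≤ μ(o↔c, z↔c) + Σ_{∅≠S⊆A∖z} U_S`. [folklore] -/
theorem neg_le (w : Sym2 (Fin n) → unitInterval) (A : Finset (Fin n)) (o c z : Fin n) (ho : o ∉ A) :
    (prodBernoulli w).real ((⋃ a ∈ A, (openConn o a : Set (BondConfig (Fin n)))) ∩ openConn z c) ≤
      (prodBernoulli w).real (openConn o c ∩ openConn z c) +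
      ∑ S ∈ (A.erase z).powerset.filter (fun S => S.Nonempty),
        (prodBernoulli w).real
          ({ω : BondConfig (Fin n) | ∀ s ∈ insert o S, ∀ x ∈ A \ S, ¬ (openGraph ω).Reachable s x} ∩
            ((⋃ s ∈ S, (openConn s o : Set (BondConfig (Fin n)))) ∩
              ⋂ x ∈ A \ S, (openConn x c : Set (BondConfig (Fin n))))) := by
  have hm : ∀ s : Set (BondConfig (Fin n)), MeasurableSet s := fun _ => MeasurableSet.of_discrete
  have hsplit := measureReal_inter_add_sdiff (μ := prodBernoulli w)
    (s := (⋃ a ∈ A, (openConn o a : Set (BondConfig (Fin n)))) ∩ openConn z c) (hm (openConn o c))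
  rw [← hsplit]
  apply add_le_add
  · refine measureReal_mono (h₂ := measure_ne_top _ _) ?_
    rintro ω ⟨⟨-, hzc⟩, hoc⟩; exact ⟨hoc, hzc⟩
  · rw [Set.sdiff_eq]
    exact (measureReal_mono (h₂ := measure_ne_top _ _) (negEvent_subset A o c z ho)).trans
      (measureReal_biUnion_finset_le _ _)

/-! ### The refined BHK steps per `S` and the termwise bound -/

/-- From `A m_S ≤ P T`, `P U ≤ A m_R`, `0 ≤ T, U ≤ P`: `(A / P)(m_S − m_R) ≤ T − U` (with `x / 0 = 0`). [folklore] -/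
theorem arith_term {Av P T U mS mR : ℝ} (hTP : T ≤ P) (hUP : U ≤ P) (hT : 0 ≤ T) (hU : 0 ≤ U)
    (i1 : Av * mS ≤ P * T) (i2 : P * U ≤ Av * mR) : Av / P * (mS - mR) ≤ T - U := by
  by_cases hP : P = 0
  · subst hP
    have hT0 : T = 0 := le_antisymm hTP hT
    have hU0 : U = 0 := le_antisymm hUP hU
    rw [div_zero, zero_mul, hT0, hU0, sub_zero]
  · have hPpos : 0 < P := lt_of_le_of_ne (hT.trans hTP) (Ne.symm hP)
    rw [div_mul_eq_mul_div, div_le_iff₀ hPpos]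
    nlinarith [i1, i2]

/-- For `∅ ≠ S ⊆ A ∖ {z}`, `o ∉ A`: `T_S − U_S ≥ (A_S / P_S) · (m_S − m_R)` (two refined set-BHK steps, tools = the landed
`stub_bhkSets`; when `P_S = 0` both sides vanish). [cite: VandenbergHaggstromKahn2005, Thms. 1.3–1.4 (pp. 6–7)] -/
theorem term_ge (w : Sym2 (Fin n) → unitInterval) (A S : Finset (Fin n)) (o c : Fin n) (ho : o ∉ A) :
    (prodBernoulli w).real
        ({ω : BondConfig (Fin n) | ∀ s ∈ insert o S, ∀ x ∈ A \ S, ¬ (openGraph ω).Reachable s x} ∩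
          ⋃ s ∈ S, (openConn s o : Set (BondConfig (Fin n)))) /
      (prodBernoulli w).real {ω : BondConfig (Fin n) | ∀ s ∈ insert o S, ∀ x ∈ A \ S, ¬ (openGraph ω).Reachable s x} *
      ((prodBernoulli w).real
          ({ω : BondConfig (Fin n) | ∀ s ∈ insert o S, ∀ x ∈ A \ S, ¬ (openGraph ω).Reachable s x} ∩
            ⋂ s ∈ S, (openConn s c : Set (BondConfig (Fin n)))) -
        (prodBernoulli w).real
          ({ω : BondConfig (Fin n) | ∀ s ∈ insert o S, ∀ x ∈ A \ S, ¬ (openGraph ω).Reachable s x} ∩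
            ⋂ x ∈ A \ S, (openConn x c : Set (BondConfig (Fin n))))) ≤
    (prodBernoulli w).real
        ({ω : BondConfig (Fin n) | ∀ s ∈ insert o S, ∀ x ∈ A \ S, ¬ (openGraph ω).Reachable s x} ∩
          ((⋃ s ∈ S, (openConn s o : Set (BondConfig (Fin n)))) ∩ ⋂ s ∈ S, (openConn s c : Set (BondConfig (Fin n))))) -
      (prodBernoulli w).real
        ({ω : BondConfig (Fin n) | ∀ s ∈ insert o S, ∀ x ∈ A \ S, ¬ (openGraph ω).Reachable s x} ∩
          ((⋃ s ∈ S, (openConn s o : Set (BondConfig (Fin n)))) ∩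
            ⋂ x ∈ A \ S, (openConn x c : Set (BondConfig (Fin n))))) := by
  have hOS : S ⊆ insert o S := Finset.subset_insert o S
  have hSX : ∀ s ∈ insert o S, s ∉ (↑(A \ S) : Set (Fin n)) := by
    intro s hs
    rw [Finset.mem_coe, Finset.mem_sdiff]
    rcases Finset.mem_insert.1 hs with rfl | hsS
    · exact fun h => ho h.1
    · exact fun h => h.2 hsS
  have hdisj : Disjoint (insert o S) (A \ S) := by
    rw [Finset.disjoint_left]
    intro s hs hs'
    exact hSX s hs (Finset.mem_coe.2 hs')
  have i1 := knRef_bhkOne stub_bhkSets.1 w (insert o S) S hOS (↑(A \ S) : Set (Fin n)) o c hSX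
  have i2 := knRef_bhkTwo stub_bhkSets.2 w (insert o S) (A \ S) S (A \ S) hOS subset_rfl o c hdisj
  have hset : {ω : BondConfig (Fin n) | ∀ s ∈ insert o S, ∀ x ∈ (↑(A \ S) : Set (Fin n)), ¬ (openGraph ω).Reachable s x} =
      {ω : BondConfig (Fin n) | ∀ s ∈ insert o S, ∀ x ∈ A \ S, ¬ (openGraph ω).Reachable s x} := by
    ext ω; simp only [mem_setOf_eq, Finset.mem_coe]
  rw [hset] at i1
  exact arith_term
    (measureReal_mono (h₂ := measure_ne_top _ _) inter_subset_left)
    (measureReal_mono (h₂ := measure_ne_top _ _) inter_subset_left)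
    measureReal_nonneg measureReal_nonneg i1 i2

/-- **`X ≥ Σ_S (A_S/P_S)(m_S − m_R)`**: the `k`-relay refined Kozma–Nitzan exchange at the designated relay `z`.
[cite: KozmaNitzan2024, Theorem 2 (§3.2, pp. 8–9); VandenbergHaggstromKahn2005, Thms. 1.3–1.4 (pp. 6–7)] -/
theorem X_ge_sum (w : Sym2 (Fin n) → unitInterval) (A : Finset (Fin n)) (o c z : Fin n) (ho : o ∉ A) (hz : z ∈ A) :
    ∑ S ∈ (A.erase z).powerset.filter (fun S => S.Nonempty),
      (prodBernoulli w).real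
          ({ω : BondConfig (Fin n) | ∀ s ∈ insert o S, ∀ x ∈ A \ S, ¬ (openGraph ω).Reachable s x} ∩
            ⋃ s ∈ S, (openConn s o : Set (BondConfig (Fin n)))) /
        (prodBernoulli w).real {ω : BondConfig (Fin n) | ∀ s ∈ insert o S, ∀ x ∈ A \ S, ¬ (openGraph ω).Reachable s x} *
        ((prodBernoulli w).real
            ({ω : BondConfig (Fin n) | ∀ s ∈ insert o S, ∀ x ∈ A \ S, ¬ (openGraph ω).Reachable s x} ∩
              ⋂ s ∈ S, (openConn s c : Set (BondConfig (Fin n)))) -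
          (prodBernoulli w).real
            ({ω : BondConfig (Fin n) | ∀ s ∈ insert o S, ∀ x ∈ A \ S, ¬ (openGraph ω).Reachable s x} ∩
              ⋂ x ∈ A \ S, (openConn x c : Set (BondConfig (Fin n))))) ≤
    (prodBernoulli w).real ((⋃ a ∈ A, (openConn o a : Set (BondConfig (Fin n)))) ∩ openConn o c) -
      (prodBernoulli w).real ((⋃ a ∈ A, (openConn o a : Set (BondConfig (Fin n)))) ∩ openConn z c) := by
  have h1 := pos_ge w A o c z hz
  have h2 := neg_le w A o c z ho
  have h3 : ∑ S ∈ (A.erase z).powerset.filter (fun S => S.Nonempty),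
      (prodBernoulli w).real
          ({ω : BondConfig (Fin n) | ∀ s ∈ insert o S, ∀ x ∈ A \ S, ¬ (openGraph ω).Reachable s x} ∩
            ⋃ s ∈ S, (openConn s o : Set (BondConfig (Fin n)))) /
        (prodBernoulli w).real {ω : BondConfig (Fin n) | ∀ s ∈ insert o S, ∀ x ∈ A \ S, ¬ (openGraph ω).Reachable s x} *
        ((prodBernoulli w).real
            ({ω : BondConfig (Fin n) | ∀ s ∈ insert o S, ∀ x ∈ A \ S, ¬ (openGraph ω).Reachable s x} ∩
              ⋂ s ∈ S, (openConn s c : Set (BondConfig (Fin n)))) -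
          (prodBernoulli w).real
            ({ω : BondConfig (Fin n) | ∀ s ∈ insert o S, ∀ x ∈ A \ S, ¬ (openGraph ω).Reachable s x} ∩
              ⋂ x ∈ A \ S, (openConn x c : Set (BondConfig (Fin n))))) ≤
      ∑ S ∈ (A.erase z).powerset.filter (fun S => S.Nonempty),
        ((prodBernoulli w).real
          ({ω : BondConfig (Fin n) | ∀ s ∈ insert o S, ∀ x ∈ A \ S, ¬ (openGraph ω).Reachable s x} ∩
            ((⋃ s ∈ S, (openConn s o : Set (BondConfig (Fin n)))) ∩ ⋂ s ∈ S, (openConn s c : Set (BondConfig (Fin n))))) -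
        (prodBernoulli w).real
          ({ω : BondConfig (Fin n) | ∀ s ∈ insert o S, ∀ x ∈ A \ S, ¬ (openGraph ω).Reachable s x} ∩
            ((⋃ s ∈ S, (openConn s o : Set (BondConfig (Fin n)))) ∩
              ⋂ x ∈ A \ S, (openConn x c : Set (BondConfig (Fin n)))))) :=
    Finset.sum_le_sum fun S _ => term_ge w A S o c ho
  rw [Finset.sum_sub_distrib] at h3
  linarith

end RKNS

open RKNS

/-- **`(RKNS)_k ⟹ EG_k` at the designated relay.**  For `o ∉ A`, `z ∈ A`: if the refined residual row
`Σ_{∅≠S⊆A∖z} (A_S / P_S)·(m_S − m_R) + μ(o↮A, z↮c) ≥ 0` holds (notation in the module docstring), then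
`μ({o↔A} ∖ {o↔c}) ≤ μ(z ↮ c)`. [this file] -/
theorem eventGluing_of_rkns_at (w : Sym2 (Fin n) → unitInterval) (A : Finset (Fin n)) (o c z : Fin n)
    (ho : o ∉ A) (hz : z ∈ A)
    (hR : 0 ≤ ∑ S ∈ (A.erase z).powerset.filter (fun S => S.Nonempty),
      (prodBernoulli w).real
          ({ω : BondConfig (Fin n) | ∀ s ∈ insert o S, ∀ x ∈ A \ S, ¬ (openGraph ω).Reachable s x} ∩
            ⋃ s ∈ S, (openConn s o : Set (BondConfig (Fin n)))) /
        (prodBernoulli w).real {ω : BondConfig (Fin n) | ∀ s ∈ insert o S, ∀ x ∈ A \ S, ¬ (openGraph ω).Reachable s x} *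
        ((prodBernoulli w).real
            ({ω : BondConfig (Fin n) | ∀ s ∈ insert o S, ∀ x ∈ A \ S, ¬ (openGraph ω).Reachable s x} ∩
              ⋂ s ∈ S, (openConn s c : Set (BondConfig (Fin n)))) -
          (prodBernoulli w).real
            ({ω : BondConfig (Fin n) | ∀ s ∈ insert o S, ∀ x ∈ A \ S, ¬ (openGraph ω).Reachable s x} ∩
              ⋂ x ∈ A \ S, (openConn x c : Set (BondConfig (Fin n))))) +
      (prodBernoulli w).real ((⋃ a ∈ A, (openConn o a : Set (BondConfig (Fin n))))ᶜ ∩ (openConn z c)ᶜ)) :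
    (prodBernoulli w).real ((⋃ a ∈ A, (openConn o a : Set (BondConfig (Fin n)))) \ openConn o c) ≤
      (prodBernoulli w).real ((openConn z c)ᶜ : Set (BondConfig (Fin n))) := by
  have hX := X_ge_sum w A o c z ho hz
  have hm : ∀ s : Set (BondConfig (Fin n)), MeasurableSet s := fun _ => MeasurableSet.of_discrete
  have h1 := measureReal_inter_add_sdiff (μ := prodBernoulli w)
    (s := ⋃ a ∈ A, (openConn o a : Set (BondConfig (Fin n)))) (hm (openConn o c)) (h := measure_ne_top _ _)
  have h2 := measureReal_inter_add_sdiff (μ := prodBernoulli w)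
    (s := ⋃ a ∈ A, (openConn o a : Set (BondConfig (Fin n)))) (hm (openConn z c)) (h := measure_ne_top _ _)
  have h3 := measureReal_inter_add_sdiff (μ := prodBernoulli w)
    (s := ((openConn z c)ᶜ : Set (BondConfig (Fin n)))) (hm (⋃ a ∈ A, (openConn o a : Set (BondConfig (Fin n)))))
    (h := measure_ne_top _ _)
  have e1 : ((openConn z c)ᶜ : Set (BondConfig (Fin n))) ∩ (⋃ a ∈ A, (openConn o a : Set (BondConfig (Fin n)))) =
      (⋃ a ∈ A, (openConn o a : Set (BondConfig (Fin n)))) \ openConn z c := by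
    ext ω; simp only [mem_inter_iff, mem_compl_iff, mem_sdiff]; tauto
  have e2 : ((openConn z c)ᶜ : Set (BondConfig (Fin n))) \ (⋃ a ∈ A, (openConn o a : Set (BondConfig (Fin n)))) =
      (⋃ a ∈ A, (openConn o a : Set (BondConfig (Fin n))))ᶜ ∩ (openConn z c)ᶜ := by
    ext ω; simp only [mem_inter_iff, mem_compl_iff, mem_sdiff]; tauto
  rw [e1, e2] at h3
  linarith

/-- **`(RKNS)` at a worst relay on every finite weighted graph ⟹ sharp event gluing for every `k` ⟹ `NoHeavyLowerTail`**
(stmt-CriticalPhenomena-4575), through the landed chain `noHeavyLowerTail_of_eventGluing`.  The hypothesis is the refined residual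
row for all `n, w`, relay sets `A`, observer `o ∉ A`, sink `c ∉ A`, `o ≠ c`, and designated relay `z ∈ A` that is worst
(`μ(z ↔ c) ≤ μ(a ↔ c)` for all `a ∈ A`). [this file] -/
theorem noHeavyLowerTail_of_rkns
    (hR : ∀ (n : ℕ) (w : Sym2 (Fin n) → unitInterval) (A : Finset (Fin n)) (o c z : Fin n),
      o ∉ A → c ∉ A → o ≠ c → z ∈ A →
      (∀ a ∈ A, (prodBernoulli w).real (openConn z c) ≤ (prodBernoulli w).real (openConn a c)) →
      0 ≤ ∑ S ∈ (A.erase z).powerset.filter (fun S => S.Nonempty),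
        (prodBernoulli w).real
            ({ω : BondConfig (Fin n) | ∀ s ∈ insert o S, ∀ x ∈ A \ S, ¬ (openGraph ω).Reachable s x} ∩
              ⋃ s ∈ S, (openConn s o : Set (BondConfig (Fin n)))) /
          (prodBernoulli w).real {ω : BondConfig (Fin n) | ∀ s ∈ insert o S, ∀ x ∈ A \ S, ¬ (openGraph ω).Reachable s x} *
          ((prodBernoulli w).real
              ({ω : BondConfig (Fin n) | ∀ s ∈ insert o S, ∀ x ∈ A \ S, ¬ (openGraph ω).Reachable s x} ∩
                ⋂ s ∈ S, (openConn s c : Set (BondConfig (Fin n)))) -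
            (prodBernoulli w).real
              ({ω : BondConfig (Fin n) | ∀ s ∈ insert o S, ∀ x ∈ A \ S, ¬ (openGraph ω).Reachable s x} ∩
                ⋂ x ∈ A \ S, (openConn x c : Set (BondConfig (Fin n))))) +
        (prodBernoulli w).real ((⋃ a ∈ A, (openConn o a : Set (BondConfig (Fin n))))ᶜ ∩ (openConn z c)ᶜ)) :
    Summit.CriticalPhenomena.PercolationContinuityZ3.Theses.PercNearOneGluing.NoHeavyLowerTail := by
  apply noHeavyLowerTail_of_eventGluing
  intro n w A o c s hs hcut
  by_cases hoc : o = c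
  · subst hoc
    have hempty : ((openConn o o : Set (BondConfig (Fin n)))ᶜ ∩ ⋃ a ∈ A, openConn o a) = ∅ := by
      ext ω
      simp only [mem_inter_iff, mem_compl_iff, mem_empty_iff_false, iff_false, not_and]
      intro h; exact absurd (show ω ∈ (openConn o o : Set (BondConfig (Fin _))) from SimpleGraph.Reachable.refl o) h
    rw [hempty, measureReal_empty]; exact hs
  by_cases hoA : o ∈ A
  · calc (prodBernoulli w).real ((openConn o c : Set (BondConfig (Fin n)))ᶜ ∩ ⋃ a ∈ A, openConn o a)
        ≤ (prodBernoulli w).real ((openConn o c : Set (BondConfig (Fin n)))ᶜ) :=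
          measureReal_mono (h₂ := measure_ne_top _ _) inter_subset_left
      _ ≤ s := hcut o hoA
  set A' : Finset (Fin n) := A.erase c with hA'
  have hsub : ((openConn o c : Set (BondConfig (Fin n)))ᶜ ∩ ⋃ a ∈ A, openConn o a) ⊆
      (⋃ a ∈ A', (openConn o a : Set (BondConfig (Fin n)))) \ openConn o c := by
    rintro ω ⟨hoc', hU⟩
    simp only [mem_iUnion, exists_prop] at hU
    obtain ⟨a, haA, hoa⟩ := hU
    refine ⟨?_, hoc'⟩
    simp only [mem_iUnion, exists_prop]
    refine ⟨a, ?_, hoa⟩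
    rw [hA', Finset.mem_erase]
    refine ⟨?_, haA⟩
    rintro rfl; exact hoc' hoa
  refine (measureReal_mono (h₂ := measure_ne_top _ _) hsub).trans ?_
  by_cases hne : A'.Nonempty
  swap
  · rw [Finset.not_nonempty_iff_eq_empty] at hne
    have hempty : ((⋃ a ∈ A', (openConn o a : Set (BondConfig (Fin n)))) \ openConn o c) = ∅ := by
      rw [hne]; simp
    rw [hempty, measureReal_empty]; exact hs
  obtain ⟨z, hzA', hzmin⟩ := Finset.exists_min_image A' (fun a => (prodBernoulli w).real (openConn a c)) hne
  have hoA' : o ∉ A' := fun h => hoA (Finset.mem_of_mem_erase h)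
  have hcA' : c ∉ A' := by rw [hA']; exact Finset.notMem_erase c A
  have hEG := eventGluing_of_rkns_at w A' o c z hoA' hzA' (hR n w A' o c z hoA' hcA' hoc hzA' hzmin)
  exact hEG.trans (hcut z (Finset.mem_of_mem_erase hzA'))

end

end Summit.CriticalPhenomena.PercolationContinuityZ3.Theorems
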